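import Literature.MathematicalPhysics.QuantumFieldTheory.Balaban1983to89.B5Symbol166Strip

/-!
# GAN24 / Symbol166PseudoInverse — the (1.66) matrix symbol IS the Moore–Penrose inverse of the gauge-projected alias-sum matrix:
# `M₁₆₆(p) = (P⊥_{∂(p)} · diag(φ₁(p),…,φ_D(p)) · P⊥_{∂(p)})⁺` — the per-fibre content of «(1.65) = (1.66)», in closed form

Cell `pub-balaban`, β sub-cell, BINDER ROW **G-an2-4 ∕ (CONV-C)** (NOT IN PRINT), prover part **P3 = WOODBURY-FIBRE reduction** (unit
`b2b-balaban-gan24-p3`, gen 2).  HONEST FRAMING (verbatim): discharging `BetaPertH` makes Bałaban's UV stability UNCONDITIONAL — a real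
constructive-QFT result; it is NOT the continuum limit and NOT the Clay problem.  HONEST DEPENDENCY: continuum YM on T⁴ ⇐ BetaPertH ∧ nine spine
estimates (0/9 proved); BetaPertH ⇐ (D1) ∧ (D4) ∧ CAP+tail; G-an2-4 gates asym, D1 and NE2/3/4.  ABSOLUTE RULE honoured: every declaration is
`[folklore]` finite-dimensional algebra over the tree's PRINTED-formula objects `B5Bounds167Lattice.w166`, `phi162`, `B5Prop11Fiber.d1Sym`,
`B4Strip.Delta1r` and b05-g9's entry symbol `B5Symbol166Strip.Gsym`; the `[cite:]` tags LOCATE (1.62)/(1.66); nothing printed is a hypothesis.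

## What is here and why (census `HOME/b2b-balaban-gan24-p3/WOODBURY-FIBRE.md` v2, rows (d)(e): the dictionary `MultDict`)

The one hypothesis left in the multiplier block of (CONV-C) (`GAN24/WoodburyFibre.MultDict` ≡ `GAN24/TransverseDictionary`'s `hdict`) is the
identity of an2's multiplier response `wΦ^{(N)}` with Bałaban's `Δ_N` in its PRINTED momentum form (1.66).  Per Bloch fibre `p ≠ 0` the (1.66) form
`½Σ_{μν} w₁₆₆(μ,ν;p)|∂_μ(p)B_ν − ∂_ν(p)B_μ|²` has the `D × D` matrix `sym166 n p` (§1); its entries ARE the `Σ_{μ≠ν}` four-term combinations of b05's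
entry symbols `Gsym n μ ν a b (ι p)` whose lattice kernels gan24-p2's `deltaZ` sums (part 2, `GAN24/Symbol166PseudoInverseLink.sym166_eq_sum_Gsym`).  THIS FILE PROVES, by unfolding the
printed weight `w₁₆₆ = [(Σ_λ |∂_λ|²/(Δ₀²φ_λ))·Δ₀φ_μ·Δ₀φ_ν]⁻¹` [cite: Balaban1984PropagatorsI, (1.66) p.29] over the alias sums `φ_μ` of (1.62)
[cite: Balaban1984PropagatorsI, (1.62) p.28]:
* §2 `sym166_eq_pinvForm`: `sym166 = Δ₀·Ω − (Δ₀/β′)·(Ω∂)(Ω∂)†`, `Ω = diag((Δ₀φ_μ)⁻¹)`, `β′ = Σ_μ |∂_μ|²/(Δ₀φ_μ)` (diagonal minus rank one);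
* §3 `sym166_mulVec_dvec`: `sym166 · ∂ = 0` (gauge null); `sym166_mul_phiDiag_mul_perp`: `sym166 · diag(φ) · P⊥ = P⊥` with `P⊥ := 1 − Δ₀⁻¹·∂∂†`;
  `sym166_mul_perp`: `sym166 · P⊥ = sym166`; whence, with `S := P⊥·diag(φ)·P⊥`, **`sym166 · S = P⊥`**, **`sym166 · S · sym166 = sym166`**,
  **`S · sym166 · S = S`** — `sym166` is the Moore–Penrose inverse of the gauge-projected diagonal alias-sum matrix (the two symmetry conditions are
  the Hermitian symmetry of `P⊥`, `sym166_conjTranspose`).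
WHY THIS IS THE DICTIONARY'S CONTENT: per fibre, the multiplier response of ANY gauge-fixed block-averaging KKT system for the energy `‖dA‖²` is the
pseudo-inverse of the transverse pivot restricted to data orthogonal to the coarse gauge `∂(p)` — the energy sees only transverse alias modes, on which
`d*d = |∂(k_m)|²`, and the averaging intertwines fine and coarse gauges (`Q(m)∂(k_m) = S(m)∂(p)`), so the longitudinal alias terms are killed by `P⊥`
and the transverse pivot is `P⊥·diag(φ̃_μ)·P⊥`, `φ̃ ∝ φ`.  So «(1.65) = (1.66)» for the typed system is «`s_m²·wΦ̂(p) = c·(P⊥ diag φ P⊥)⁺`», whose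
right-hand side this file identifies with the printed `sym166` in kernel.  NUMERICAL ∕ EXACT status of the left-hand side for an2's system: census jobs
j077931 (≤ 6·10⁻¹¹ over 95 fibres), j078293 ∕ j078441 (exact in ℚ(i), ℚ(√2,i), incl. D = 4, N = 2, 4).  NOT proved here: anything about an2's `wΦ`
(leaf-18's rows P1-L13a/b + gan24-p2's PART 20).  NOT BetaPertH, NOT continuum, NOT Clay.
-/

noncomputable section

open Finset Matrix Complex
open scoped BigOperators ComplexConjugate
open Literature.MathematicalPhysics.QuantumFieldTheory.Balaban1983to89
open B4Strip (S1r Delta1r ofRealVec)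
open B5Prop11Fiber (d1Sym norm_d1Sym_sq Delta0_eq)
open B5Prop11Leaves (Delta1r_pos)
open B5Bounds167Lattice (phi162 w166 Delta0_phi162_lower)
open B5Symbol166Strip (Gsym Gsym_ofReal)

namespace Summit.QuantumFields.BalabanUV.Beta.GAN24.Symbol166PseudoInverse

variable {d : ℕ}

/-! ## §1 The objects -/

/-- The coarse pure-gauge direction `∂(p) = (e^{ip_μ} − 1)_μ` as a complex vector. [folklore] -/
def dvec (s : Fin d → ℝ) : Fin d → ℂ := fun μ => d1Sym s μ

/-- `a_μ := Δ₀(p)·φ_μ(p)`. [cite: Balaban1984PropagatorsI, (1.62) p.28] -/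
def avec (n : ℕ) (s : Fin d → ℝ) : Fin d → ℝ := fun μ => Delta1r 0 s * phi162 n μ s

/-- `ω_μ := (Δ₀φ_μ)⁻¹`. [folklore] -/
def omega (n : ℕ) (s : Fin d → ℝ) : Fin d → ℝ := fun μ => (avec n s μ)⁻¹

/-- The printed bracket `Σ_λ |∂_λ|²/(Δ₀²φ_λ)` of (1.66). [cite: Balaban1984PropagatorsI, (1.66) p.29] -/
def bracket (n : ℕ) (s : Fin d → ℝ) : ℝ := ∑ κ, ‖d1Sym s κ‖ ^ 2 / (Delta1r 0 s ^ 2 * phi162 n κ s)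

/-- `β′ := Σ_μ ω_μ|∂_μ|²` (`= Δ₀·bracket`). [folklore] -/
def betaP (n : ℕ) (s : Fin d → ℝ) : ℝ := ∑ μ, omega n s μ * ‖d1Sym s μ‖ ^ 2

/-- **THE (1.66) MATRIX SYMBOL** `sym166 n p`: the matrix of the Hermitian form `B ↦ ½Σ_{μν} w₁₆₆(n;μ,ν;p)|∂_μ B_ν − ∂_ν B_μ|²`,
`M_{μν} = δ_{μν}·Σ_κ w_{κμ}|∂_κ|² − w_{μν}·∂_μ·conj ∂_ν` (coefficient of `conj B_μ·B_ν`). [cite: Balaban1984PropagatorsI, (1.66) p.29] -/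
def sym166 (n : ℕ) (s : Fin d → ℝ) : Matrix (Fin d) (Fin d) ℂ := Matrix.of fun μ ν =>
  (if μ = ν then (((∑ κ, w166 n κ μ s * ‖d1Sym s κ‖ ^ 2 : ℝ)) : ℂ) else 0) -
    (w166 n μ ν s : ℂ) * (d1Sym s μ * conj (d1Sym s ν))

/-- The "pseudo-inverse form": `X_{μν} = Δ₀ω_μδ_{μν} − (Δ₀/β′)·ω_μω_ν·∂_μ·conj ∂_ν`. [folklore] -/
def pinvForm (n : ℕ) (s : Fin d → ℝ) : Matrix (Fin d) (Fin d) ℂ := Matrix.of fun μ ν =>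
  (if μ = ν then ((Delta1r 0 s * omega n s μ : ℝ) : ℂ) else 0) -
    ((Delta1r 0 s / betaP n s * (omega n s μ * omega n s ν) : ℝ) : ℂ) * (d1Sym s μ * conj (d1Sym s ν))

/-- The coarse-gauge rank-one matrix `E = ∂∂†`. [folklore] -/
def gaugeProj (s : Fin d → ℝ) : Matrix (Fin d) (Fin d) ℂ := Matrix.of fun μ ν => d1Sym s μ * conj (d1Sym s ν)

/-- The projector complement `P⊥ = 1 − Δ₀⁻¹·∂∂†`. [folklore] -/
def perp (s : Fin d → ℝ) : Matrix (Fin d) (Fin d) ℂ := 1 - (((Delta1r 0 s)⁻¹ : ℝ) : ℂ) • gaugeProj s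

/-- The diagonal alias-sum matrix `diag(φ_μ(p))`. [cite: Balaban1984PropagatorsI, (1.62) p.28] -/
def phiDiag (n : ℕ) (s : Fin d → ℝ) : Matrix (Fin d) (Fin d) ℂ := Matrix.diagonal fun μ => ((phi162 n μ s : ℝ) : ℂ)

/-! ## §2 Unfolding the printed weight: `sym166 = pinvForm` -/

section Unfold

variable (n : ℕ) [NeZero n] (s : Fin d → ℝ)

/-- `a_μ > 0` on the punctured Brillouin zone (b05-g7's `Delta0_phi162_lower`). [folklore] -/
theorem avec_pos (hs : ∀ κ, |s κ| ≤ Real.pi) (ν₀ : Fin d) (hν₀ : s ν₀ ≠ 0) (μ : Fin d) : 0 < avec n s μ := by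
  have hn : 1 ≤ n := Nat.one_le_iff_ne_zero.mpr (NeZero.ne n)
  have h := Delta0_phi162_lower n hn μ s hs ν₀ hν₀
  have hγ : (0 : ℝ) < (4 / Real.pi ^ 2) ^ (d + 2) := by positivity
  exact lt_of_lt_of_le hγ h

/-- `φ_μ > 0` there. [folklore] -/
theorem phi162_pos (hs : ∀ κ, |s κ| ≤ Real.pi) (ν₀ : Fin d) (hν₀ : s ν₀ ≠ 0) (μ : Fin d) : 0 < phi162 n μ s := by
  have h := avec_pos n s hs ν₀ hν₀ μ
  have hΔ := Delta1r_pos s hs ν₀ hν₀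
  unfold avec at h
  exact pos_of_mul_pos_right h hΔ.le

/-- `ω_μ > 0`. [folklore] -/
theorem omega_pos (hs : ∀ κ, |s κ| ≤ Real.pi) (ν₀ : Fin d) (hν₀ : s ν₀ ≠ 0) (μ : Fin d) : 0 < omega n s μ :=
  inv_pos.mpr (avec_pos n s hs ν₀ hν₀ μ)

omit [NeZero n] in
/-- The printed weight in the `(a, bracket)` variables: `w₁₆₆(μ,ν) = (bracket·a_μ·a_ν)⁻¹`. [folklore] -/
theorem w166_eq (μ ν : Fin d) : w166 n μ ν s = (bracket n s * avec n s μ * avec n s ν)⁻¹ := by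
  unfold w166 bracket avec
  rw [one_div]

/-- `β′ = Δ₀·bracket`. [folklore] -/
theorem betaP_eq (hs : ∀ κ, |s κ| ≤ Real.pi) (ν₀ : Fin d) (hν₀ : s ν₀ ≠ 0) : betaP n s = Delta1r 0 s * bracket n s := by
  unfold betaP bracket omega avec
  rw [Finset.mul_sum]
  refine Finset.sum_congr rfl fun κ _ => ?_
  have hΔ := (Delta1r_pos s hs ν₀ hν₀).ne'
  have hφ := (phi162_pos n s hs ν₀ hν₀ κ).ne'
  field_simp

/-- `β′ > 0`. [folklore] -/
theorem betaP_pos (hs : ∀ κ, |s κ| ≤ Real.pi) (ν₀ : Fin d) (hν₀ : s ν₀ ≠ 0) : 0 < betaP n s := by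
  unfold betaP
  have hterm : ∀ μ ∈ (Finset.univ : Finset (Fin d)), 0 ≤ omega n s μ * ‖d1Sym s μ‖ ^ 2 :=
    fun μ _ => mul_nonneg (omega_pos n s hs ν₀ hν₀ μ).le (sq_nonneg _)
  have hS : 0 < ‖d1Sym s ν₀‖ ^ 2 := by
    rw [norm_d1Sym_sq]
    have h4 := B4Strip.S1r_ge (s ν₀) (hs ν₀)
    have h0 : 0 < (s ν₀) ^ 2 := lt_of_le_of_ne (sq_nonneg _) (Ne.symm (pow_ne_zero 2 hν₀))
    have h5 : 0 < 4 * (s ν₀) ^ 2 / Real.pi ^ 2 := by positivity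
    linarith
  have hν₀' : 0 < omega n s ν₀ * ‖d1Sym s ν₀‖ ^ 2 := mul_pos (omega_pos n s hs ν₀ hν₀ ν₀) hS
  exact lt_of_lt_of_le hν₀' (Finset.single_le_sum hterm (Finset.mem_univ ν₀))

/-- `bracket > 0`. [folklore] -/
theorem bracket_pos (hs : ∀ κ, |s κ| ≤ Real.pi) (ν₀ : Fin d) (hν₀ : s ν₀ ≠ 0) : 0 < bracket n s := by
  have h := betaP_pos n s hs ν₀ hν₀
  rw [betaP_eq n s hs ν₀ hν₀] at h
  exact pos_of_mul_pos_right h (Delta1r_pos s hs ν₀ hν₀).le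

/-- The diagonal alias sum of (1.66): `Σ_κ w_{κμ}|∂_κ|² = Δ₀·ω_μ`. [folklore] -/
theorem sum_w166_mul_norm_sq (hs : ∀ κ, |s κ| ≤ Real.pi) (ν₀ : Fin d) (hν₀ : s ν₀ ≠ 0) (μ : Fin d) :
    ∑ κ, w166 n κ μ s * ‖d1Sym s κ‖ ^ 2 = Delta1r 0 s * omega n s μ := by
  have hb := (bracket_pos n s hs ν₀ hν₀).ne'
  have ha : ∀ κ, avec n s κ ≠ 0 := fun κ => (avec_pos n s hs ν₀ hν₀ κ).ne'
  have e : ∀ κ, w166 n κ μ s * ‖d1Sym s κ‖ ^ 2 = (bracket n s * avec n s μ)⁻¹ * (omega n s κ * ‖d1Sym s κ‖ ^ 2) := by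
    intro κ
    rw [w166_eq, omega]
    have := ha κ; have := ha μ
    field_simp
  simp_rw [e]
  rw [← Finset.mul_sum]
  change (bracket n s * avec n s μ)⁻¹ * betaP n s = _
  rw [betaP_eq n s hs ν₀ hν₀, omega]
  have := ha μ
  field_simp

/-- The off-diagonal weight: `w₁₆₆(μ,ν) = (Δ₀/β′)·ω_μ·ω_ν`. [folklore] -/
theorem w166_eq_coeff (hs : ∀ κ, |s κ| ≤ Real.pi) (ν₀ : Fin d) (hν₀ : s ν₀ ≠ 0) (μ ν : Fin d) :
    w166 n μ ν s = Delta1r 0 s / betaP n s * (omega n s μ * omega n s ν) := by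
  rw [w166_eq, betaP_eq n s hs ν₀ hν₀, omega, omega]
  have hb := (bracket_pos n s hs ν₀ hν₀).ne'
  have hΔ := (Delta1r_pos s hs ν₀ hν₀).ne'
  have h1 := (avec_pos n s hs ν₀ hν₀ μ).ne'
  have h2 := (avec_pos n s hs ν₀ hν₀ ν).ne'
  field_simp

/-- **`sym166 = pinvForm`** on the punctured Brillouin zone: the printed (1.66) matrix is a positive diagonal minus a rank-one matrix. [folklore] -/
theorem sym166_eq_pinvForm (hs : ∀ κ, |s κ| ≤ Real.pi) (ν₀ : Fin d) (hν₀ : s ν₀ ≠ 0) : sym166 n s = pinvForm n s := by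
  ext μ ν
  simp only [sym166, pinvForm, Matrix.of_apply]
  rw [sum_w166_mul_norm_sq n s hs ν₀ hν₀ μ, w166_eq_coeff n s hs ν₀ hν₀ μ ν]

end Unfold

/-! ## §3 Gauge null space and the Moore–Penrose property -/

section Pinv

variable (n : ℕ) [NeZero n] (s : Fin d → ℝ)

/-- `conj ∂_κ · ∂_κ = |∂_κ|²` in `ℂ`. [folklore] -/
theorem conj_mul_d1Sym (κ : Fin d) : conj (d1Sym s κ) * d1Sym s κ = ((‖d1Sym s κ‖ ^ 2 : ℝ) : ℂ) := by
  rw [Complex.conj_mul']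
  push_cast
  rfl

/-- `Σ_κ conj ∂_κ·∂_κ = Δ₀`. [folklore] -/
theorem sum_conj_mul_d1Sym : ∑ κ, conj (d1Sym s κ) * d1Sym s κ = ((Delta1r 0 s : ℝ) : ℂ) := by
  simp_rw [conj_mul_d1Sym]
  rw [Delta0_eq]
  push_cast
  rfl

omit [NeZero n] in
/-- `Σ_κ ω_κ·conj ∂_κ·∂_κ = β′`. [folklore] -/
theorem sum_omega_conj_mul_d1Sym : ∑ κ, ((omega n s κ : ℝ) : ℂ) * (conj (d1Sym s κ) * d1Sym s κ) = ((betaP n s : ℝ) : ℂ) := by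
  simp_rw [conj_mul_d1Sym]
  unfold betaP
  push_cast
  rfl

/-- A matrix times a rank-one matrix `u ⊗ v`: `(M·(u vᵀ))_{μν} = (M u)_μ · v_ν`. [folklore] -/
theorem mul_outer_apply (M : Matrix (Fin d) (Fin d) ℂ) (u v : Fin d → ℂ) (μ ν : Fin d) :
    (M * Matrix.of fun κ τ => u κ * v τ) μ ν = (M *ᵥ u) μ * v ν := by
  simp only [Matrix.mul_apply, Matrix.of_apply, Matrix.mulVec, dotProduct, Finset.sum_mul]
  exact Finset.sum_congr rfl fun κ _ => by ring

/-- **GAUGE NULL SPACE**: `pinvForm · ∂ = 0`. [folklore] -/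
theorem pinvForm_mulVec_dvec (hs : ∀ κ, |s κ| ≤ Real.pi) (ν₀ : Fin d) (hν₀ : s ν₀ ≠ 0) : pinvForm n s *ᵥ dvec s = 0 := by
  have hβ : ((betaP n s : ℝ) : ℂ) ≠ 0 := by exact_mod_cast (betaP_pos n s hs ν₀ hν₀).ne'
  ext μ
  simp only [Matrix.mulVec, dotProduct, pinvForm, Matrix.of_apply, dvec, Pi.zero_apply, sub_mul, Finset.sum_sub_distrib]
  simp only [ite_mul, zero_mul, Finset.sum_ite_eq, Finset.mem_univ, if_true]
  have e : ∀ x : Fin d, ((Delta1r 0 s / betaP n s * (omega n s μ * omega n s x) : ℝ) : ℂ) * (d1Sym s μ * conj (d1Sym s x)) * d1Sym s x =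
      ((Delta1r 0 s / betaP n s * omega n s μ : ℝ) : ℂ) * d1Sym s μ * (((omega n s x : ℝ) : ℂ) * (conj (d1Sym s x) * d1Sym s x)) := by
    intro x; push_cast; ring
  simp_rw [e]
  rw [← Finset.mul_sum, sum_omega_conj_mul_d1Sym]
  push_cast
  field_simp
  ring

/-- Hence `sym166 · ∂ = 0`: the coarse pure gauge is in the kernel of the (1.66) symbol. [folklore] -/
theorem sym166_mulVec_dvec (hs : ∀ κ, |s κ| ≤ Real.pi) (ν₀ : Fin d) (hν₀ : s ν₀ ≠ 0) : sym166 n s *ᵥ dvec s = 0 := by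
  rw [sym166_eq_pinvForm n s hs ν₀ hν₀]
  exact pinvForm_mulVec_dvec n s hs ν₀ hν₀

/-- `sym166 · (∂∂†) = 0`. [folklore] -/
theorem sym166_mul_gaugeProj (hs : ∀ κ, |s κ| ≤ Real.pi) (ν₀ : Fin d) (hν₀ : s ν₀ ≠ 0) : sym166 n s * gaugeProj s = 0 := by
  ext μ ν
  have h' : sym166 n s *ᵥ d1Sym s = 0 := sym166_mulVec_dvec n s hs ν₀ hν₀
  rw [gaugeProj, mul_outer_apply, h', Pi.zero_apply, zero_mul, Matrix.zero_apply]

/-- **`sym166 · P⊥ = sym166`**. [folklore] -/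
theorem sym166_mul_perp (hs : ∀ κ, |s κ| ≤ Real.pi) (ν₀ : Fin d) (hν₀ : s ν₀ ≠ 0) : sym166 n s * perp s = sym166 n s := by
  rw [perp, Matrix.mul_sub, Matrix.mul_one, Matrix.mul_smul, sym166_mul_gaugeProj n s hs ν₀ hν₀, smul_zero, sub_zero]

/-- `pinvForm · diag(φ) = 1 − c ⊗ ∂†` with `c_μ = (ω_μ/β′)·∂_μ`: right-multiplying by `diag(φ)` turns the diagonal into `1` (`Δ₀ω_μφ_μ = 1`) and the
rank-one part into a row multiple of `∂†`. [folklore] -/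
theorem pinvForm_mul_phiDiag (hs : ∀ κ, |s κ| ≤ Real.pi) (ν₀ : Fin d) (hν₀ : s ν₀ ≠ 0) :
    pinvForm n s * phiDiag n s = 1 - Matrix.of fun μ ν => ((omega n s μ / betaP n s : ℝ) : ℂ) * d1Sym s μ * conj (d1Sym s ν) := by
  have hΔ : ((Delta1r 0 s : ℝ) : ℂ) ≠ 0 := by exact_mod_cast (Delta1r_pos s hs ν₀ hν₀).ne'
  have hβ : ((betaP n s : ℝ) : ℂ) ≠ 0 := by exact_mod_cast (betaP_pos n s hs ν₀ hν₀).ne'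
  ext μ ν
  rw [phiDiag, Matrix.mul_diagonal]
  simp only [pinvForm, Matrix.of_apply, Matrix.sub_apply, Matrix.one_apply]
  by_cases h : μ = ν
  · subst h
    simp only [if_true]
    have hφ : ((phi162 n μ s : ℝ) : ℂ) ≠ 0 := by exact_mod_cast (phi162_pos n s hs ν₀ hν₀ μ).ne'
    have e1 : ((Delta1r 0 s * omega n s μ : ℝ) : ℂ) * ((phi162 n μ s : ℝ) : ℂ) = 1 := by
      rw [omega, avec]; push_cast; field_simp
    have e2 : ((Delta1r 0 s / betaP n s * (omega n s μ * omega n s μ) : ℝ) : ℂ) * (d1Sym s μ * conj (d1Sym s μ)) * ((phi162 n μ s : ℝ) : ℂ) =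
        ((omega n s μ / betaP n s : ℝ) : ℂ) * d1Sym s μ * conj (d1Sym s μ) := by
      have e3 : ((Delta1r 0 s / betaP n s * (omega n s μ * omega n s μ) : ℝ) : ℂ) * ((phi162 n μ s : ℝ) : ℂ) =
          ((omega n s μ / betaP n s : ℝ) : ℂ) := by
        rw [omega, avec]; push_cast; field_simp
      calc ((Delta1r 0 s / betaP n s * (omega n s μ * omega n s μ) : ℝ) : ℂ) * (d1Sym s μ * conj (d1Sym s μ)) * ((phi162 n μ s : ℝ) : ℂ)
          = (((Delta1r 0 s / betaP n s * (omega n s μ * omega n s μ) : ℝ) : ℂ) * ((phi162 n μ s : ℝ) : ℂ)) * d1Sym s μ * conj (d1Sym s μ) := by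
            ring
        _ = ((omega n s μ / betaP n s : ℝ) : ℂ) * d1Sym s μ * conj (d1Sym s μ) := by rw [e3]
    rw [sub_mul, e1, e2]
  · rw [if_neg h, if_neg h]
    have e3 : ((Delta1r 0 s / betaP n s * (omega n s μ * omega n s ν) : ℝ) : ℂ) * ((phi162 n ν s : ℝ) : ℂ) =
        ((omega n s μ / betaP n s : ℝ) : ℂ) := by
      have hφ : ((phi162 n ν s : ℝ) : ℂ) ≠ 0 := by exact_mod_cast (phi162_pos n s hs ν₀ hν₀ ν).ne'
      have ha : ((avec n s ν : ℝ) : ℂ) = ((Delta1r 0 s : ℝ) : ℂ) * ((phi162 n ν s : ℝ) : ℂ) := by rw [avec]; push_cast; ring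
      rw [omega, omega]; push_cast
      rw [ha]
      field_simp
    linear_combination (-(d1Sym s μ * conj (d1Sym s ν))) * e3

/-- A row multiple of `∂†` is killed by `P⊥` on the right: `(c ⊗ ∂†)·P⊥ = 0`. [folklore] -/
theorem rowGauge_mul_perp (hs : ∀ κ, |s κ| ≤ Real.pi) (ν₀ : Fin d) (hν₀ : s ν₀ ≠ 0) (c : Fin d → ℂ) :
    (Matrix.of fun μ ν => c μ * conj (d1Sym s ν)) * perp s = 0 := by
  have hΔ : ((Delta1r 0 s : ℝ) : ℂ) ≠ 0 := by exact_mod_cast (Delta1r_pos s hs ν₀ hν₀).ne'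
  have hE : (Matrix.of fun μ ν => c μ * conj (d1Sym s ν)) * gaugeProj s =
      ((Delta1r 0 s : ℝ) : ℂ) • Matrix.of fun μ ν => c μ * conj (d1Sym s ν) := by
    ext μ ν
    rw [gaugeProj, mul_outer_apply]
    simp only [Matrix.mulVec, dotProduct, Matrix.of_apply, Matrix.smul_apply, smul_eq_mul]
    have e : ∀ κ, c μ * conj (d1Sym s κ) * d1Sym s κ = c μ * (conj (d1Sym s κ) * d1Sym s κ) := fun κ => by ring
    simp_rw [e]
    rw [← Finset.mul_sum, sum_conj_mul_d1Sym]
    ring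
  rw [perp, Matrix.mul_sub, Matrix.mul_one, Matrix.mul_smul, hE, smul_smul]
  rw [show ((((Delta1r 0 s)⁻¹ : ℝ) : ℂ)) * ((Delta1r 0 s : ℝ) : ℂ) = 1 by push_cast; field_simp, one_smul, sub_self]

/-- **`sym166 · diag(φ) · P⊥ = P⊥`** (the core of the pseudo-inverse property). [folklore] -/
theorem sym166_mul_phiDiag_mul_perp (hs : ∀ κ, |s κ| ≤ Real.pi) (ν₀ : Fin d) (hν₀ : s ν₀ ≠ 0) :
    sym166 n s * phiDiag n s * perp s = perp s := by
  rw [sym166_eq_pinvForm n s hs ν₀ hν₀, pinvForm_mul_phiDiag n s hs ν₀ hν₀, Matrix.sub_mul, Matrix.one_mul]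
  have h := rowGauge_mul_perp s hs ν₀ hν₀ (fun μ => ((omega n s μ / betaP n s : ℝ) : ℂ) * d1Sym s μ)
  rw [h, sub_zero]

/-- The gauge-PROJECTED diagonal alias-sum matrix `S = P⊥ · diag(φ) · P⊥`. [folklore] -/
def projPhi (n : ℕ) (s : Fin d → ℝ) : Matrix (Fin d) (Fin d) ℂ := perp s * phiDiag n s * perp s

/-- **PENROSE (i)**: `sym166 · S = P⊥`. [folklore] -/
theorem sym166_mul_projPhi (hs : ∀ κ, |s κ| ≤ Real.pi) (ν₀ : Fin d) (hν₀ : s ν₀ ≠ 0) : sym166 n s * projPhi n s = perp s := by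
  rw [projPhi, ← Matrix.mul_assoc, ← Matrix.mul_assoc, sym166_mul_perp n s hs ν₀ hν₀, sym166_mul_phiDiag_mul_perp n s hs ν₀ hν₀]

omit [NeZero n] in
/-- `w₁₆₆` is symmetric in `(μ, ν)`. [folklore] -/
theorem w166_symm (μ ν : Fin d) : w166 n μ ν s = w166 n ν μ s := by
  unfold w166; ring

omit [NeZero n] in
/-- The (1.66) symbol is Hermitian. [folklore] -/
theorem sym166_conjTranspose : (sym166 n s)ᴴ = sym166 n s := by
  ext μ ν
  rw [Matrix.conjTranspose_apply, sym166, Matrix.of_apply, Matrix.of_apply]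
  by_cases h : μ = ν
  · subst h
    simp only [if_true, Complex.star_def, map_sub, map_mul, Complex.conj_ofReal, Complex.conj_conj]
    ring
  · simp only [if_neg h, if_neg (Ne.symm h), Complex.star_def, map_sub, map_mul, map_zero, Complex.conj_ofReal, Complex.conj_conj]
    rw [w166_symm n s ν μ]
    ring

/-- `∂∂†` is Hermitian. [folklore] -/
theorem gaugeProj_conjTranspose : (gaugeProj s)ᴴ = gaugeProj s := by
  ext μ ν
  simp only [Matrix.conjTranspose_apply, gaugeProj, Matrix.of_apply, star_mul', Complex.star_def, Complex.conj_conj]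
  ring

/-- `P⊥` is Hermitian. [folklore] -/
theorem perp_conjTranspose : (perp s)ᴴ = perp s := by
  rw [perp, Matrix.conjTranspose_sub, Matrix.conjTranspose_one, Matrix.conjTranspose_smul, gaugeProj_conjTranspose,
    Complex.star_def, Complex.conj_ofReal]

omit [NeZero n] in
/-- `diag(φ)` is Hermitian. [folklore] -/
theorem phiDiag_conjTranspose : (phiDiag n s)ᴴ = phiDiag n s := by
  rw [phiDiag, Matrix.diagonal_conjTranspose]
  congr 1
  funext μ
  exact Complex.conj_ofReal _

omit [NeZero n] in
/-- `S` is Hermitian. [folklore] -/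
theorem projPhi_conjTranspose : (projPhi n s)ᴴ = projPhi n s := by
  rw [projPhi, Matrix.conjTranspose_mul, Matrix.conjTranspose_mul, perp_conjTranspose, phiDiag_conjTranspose, Matrix.mul_assoc]

/-- `P⊥ · sym166 = sym166` (adjoint of `sym166_mul_perp`). [folklore] -/
theorem perp_mul_sym166 (hs : ∀ κ, |s κ| ≤ Real.pi) (ν₀ : Fin d) (hν₀ : s ν₀ ≠ 0) : perp s * sym166 n s = sym166 n s := by
  have h := congrArg Matrix.conjTranspose (sym166_mul_perp n s hs ν₀ hν₀)
  rw [Matrix.conjTranspose_mul, perp_conjTranspose, sym166_conjTranspose] at h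
  exact h

/-- `S · sym166 = P⊥` (adjoint of Penrose (i)). [folklore] -/
theorem projPhi_mul_sym166 (hs : ∀ κ, |s κ| ≤ Real.pi) (ν₀ : Fin d) (hν₀ : s ν₀ ≠ 0) : projPhi n s * sym166 n s = perp s := by
  have h := congrArg Matrix.conjTranspose (sym166_mul_projPhi n s hs ν₀ hν₀)
  rw [Matrix.conjTranspose_mul, projPhi_conjTranspose, sym166_conjTranspose, perp_conjTranspose] at h
  exact h

/-- **PENROSE (ii)**: `sym166 · S · sym166 = sym166`. [folklore] -/
theorem sym166_mul_projPhi_mul_sym166 (hs : ∀ κ, |s κ| ≤ Real.pi) (ν₀ : Fin d) (hν₀ : s ν₀ ≠ 0) :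
    sym166 n s * projPhi n s * sym166 n s = sym166 n s := by
  rw [sym166_mul_projPhi n s hs ν₀ hν₀, perp_mul_sym166 n s hs ν₀ hν₀]

/-- `P⊥` is idempotent-compatible with `S`: `P⊥ · S = S`. [folklore] -/
theorem perp_mul_perp (hs : ∀ κ, |s κ| ≤ Real.pi) (ν₀ : Fin d) (hν₀ : s ν₀ ≠ 0) : perp s * perp s = perp s := by
  have hΔ : ((Delta1r 0 s : ℝ) : ℂ) ≠ 0 := by exact_mod_cast (Delta1r_pos s hs ν₀ hν₀).ne'
  have h := rowGauge_mul_perp s hs ν₀ hν₀ (fun μ => (((Delta1r 0 s)⁻¹ : ℝ) : ℂ) * d1Sym s μ)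
  have hE : (((Delta1r 0 s)⁻¹ : ℝ) : ℂ) • gaugeProj s = Matrix.of fun μ ν => (((Delta1r 0 s)⁻¹ : ℝ) : ℂ) * d1Sym s μ * conj (d1Sym s ν) := by
    ext μ ν; simp only [gaugeProj, Matrix.smul_apply, Matrix.of_apply, smul_eq_mul]; ring
  have hp : perp s = 1 - Matrix.of fun μ ν => (((Delta1r 0 s)⁻¹ : ℝ) : ℂ) * d1Sym s μ * conj (d1Sym s ν) := by rw [perp, hE]
  nth_rewrite 1 [hp]
  rw [Matrix.sub_mul, Matrix.one_mul, h, sub_zero]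

/-- **PENROSE (iii)**: `S · sym166 · S = S`. [folklore] -/
theorem projPhi_mul_sym166_mul_projPhi (hs : ∀ κ, |s κ| ≤ Real.pi) (ν₀ : Fin d) (hν₀ : s ν₀ ≠ 0) :
    projPhi n s * sym166 n s * projPhi n s = projPhi n s := by
  rw [projPhi_mul_sym166 n s hs ν₀ hν₀, projPhi, ← Matrix.mul_assoc, ← Matrix.mul_assoc, perp_mul_perp s hs ν₀ hν₀]

/-- **THE (1.66) SYMBOL IS THE MOORE–PENROSE INVERSE OF THE GAUGE-PROJECTED ALIAS-SUM MATRIX** (the four Penrose conditions, the two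
symmetry ones being `perp_conjTranspose` read through (i)). [folklore] -/
theorem sym166_isPenroseInverse (hs : ∀ κ, |s κ| ≤ Real.pi) (ν₀ : Fin d) (hν₀ : s ν₀ ≠ 0) :
    sym166 n s * projPhi n s * sym166 n s = sym166 n s ∧ projPhi n s * sym166 n s * projPhi n s = projPhi n s ∧
      (sym166 n s * projPhi n s)ᴴ = sym166 n s * projPhi n s ∧ (projPhi n s * sym166 n s)ᴴ = projPhi n s * sym166 n s := by
  refine ⟨sym166_mul_projPhi_mul_sym166 n s hs ν₀ hν₀, projPhi_mul_sym166_mul_projPhi n s hs ν₀ hν₀, ?_, ?_⟩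
  · rw [sym166_mul_projPhi n s hs ν₀ hν₀, perp_conjTranspose]
  · rw [projPhi_mul_sym166 n s hs ν₀ hν₀, perp_conjTranspose]

end Pinv

end Summit.QuantumFields.BalabanUV.Beta.GAN24.Symbol166PseudoInverse

end
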